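import Summits.QuantumFields.YangMills.Theorems.BalabanLadderNTClassicalShadowReflectionBox
import HarnessLib

/-!
# Crux `NT` (stmt-QuantumFields-19353), stub `stub_refpkgT : RefPkgT`: THE CLASSICAL SHADOW, X — symmetries UP TO GAUGE become EXACT kernel
# symmetries after absorbing the gauge transformation (so they fit the orbit-test hypothesis `ClassicalOrbitCovFloorUnbounded` verbatim)

Helper file (`--supports stmt-QuantumFields-19353`) of the fleet lead prover of crux `NT` (unit `ym-spine-19353-p1`, GEN 15); sequel of
`…ClassicalShadowReflectionBox` (this generation) and `…ClassicalShadowOrbitGauge` (p603177).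

WHY.  The classical kill-path hypothesis `ClassicalOrbitCovFloorUnbounded G r` (p609695) asks for maps `γᵢ` of the configuration space with the
EXACT kernel symmetry `kerE^η_β(F ∘ γᵢ) = kerE^η_β(F)` for ALL continuous `F`.  The frustrated boxes of the classical programme with a
NON-ABELIAN coherent exterior (`na`) are symmetric under their reflections/permutations `T` only UP TO A GLOBAL COLOUR ROTATION, `Tη = g·η`, for
which the tree gives the symmetry on gauge-INVARIANT `F` only (`kerE_perm_gauge_symm_fun`, `kerE_box{Time,Axis}Reflect_gauge_symm`).  The fix is
free: replace `T` by `γ := g⁻¹· ∘ T`.  Then `γη = η`-wise nothing is needed — the COVARIANCE of `T` for every exterior plus the gauge covariance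
`kerE_gaugeTransformZd` give the exact symmetry of `γ` on EVERY measurable `F`, and `dens ∘ γ = dens ∘ T` (gauge invariance), so the orbit sums of
the orbit test are those of `T`:

* **`kerE_symm_of_covariance_gauge`** — abstract: a map `T` with `kerE^{Tη'}(F) = kerE^{η'}(F ∘ T)` for all `η'`, `F`, and `Tη = g·η`, gives
  `kerE^η(F ∘ g⁻¹· ∘ T) = kerE^η(F)` for every measurable `F`;
* `dens_comp_gaugeFix` — `dens_x (g⁻¹·(T U)) = dens_x (T U)`;
* instances: **`kerE_gaugeFix_boxTimeReflect_symm`**, **`kerE_gaugeFix_boxAxisReflect_symm`**, **`kerE_gaugeFix_perm_symm`** (coordinate permutation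
  fixing the cube base), each with the continuity of the fixed map (`continuous_gaugeFix_…`) that the orbit test asks.

Pure bookkeeping over tree theorems; nothing about ground states; not NT; not Clay.
-/

set_option autoImplicit false

noncomputable section

open MeasureTheory Filter Topology
open Literature.MathematicalPhysics.QuantumFieldTheory Literature.MathematicalPhysics.QuantumLattice
open Literature.Probability.LatticeModels
open Summit.QuantumFields.YangMills.Cruxes.OSLegsFromFemtoAndGap.DlrCollarTransfer

namespace Summit.QuantumFields.YangMills.Cruxes.NT.ClassicalShadow

variable {G : Type} [Group G] [TopologicalSpace G] [IsTopologicalGroup G] [CompactSpace G]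
  [MeasurableSpace G] [BorelSpace G] (r : LatticeRep G)

/-! ## §1 The abstract gauge fix -/

/-- **Symmetry up to gauge ⇒ exact symmetry of the gauge-fixed map.**  Let `T` be a map of configurations under which the cube kernels
are COVARIANT for every exterior (`kerE^{Tη'}_{c,b}(F) = kerE^{η'}_{c,b}(F ∘ T)`, all measurable `F`), and let the exterior `η` be `T`-symmetric up
to the gauge transformation `g` (`Tη = g·η`).  Then `γ := g⁻¹· ∘ T` is an EXACT kernel symmetry of `η`: `kerE^η(F ∘ γ) = kerE^η(F)` for every
measurable `F` (gauge-invariant or not). [folklore] -/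
theorem kerE_symm_of_covariance_gauge (β : ℝ) (c : Fin 4 → ℤ) (b : ℕ) {T : LGConfig 4 G → LGConfig 4 G}
    (hcov : ∀ (η' : LGConfig 4 G) (F : LGConfig 4 G → ℝ), Measurable F → kerE G r β c b (T η') F = kerE G r β c b η' (F ∘ T))
    {η : LGConfig 4 G} {g : Site 4 → G} (hη : T η = gaugeTransformZd g η) {F : LGConfig 4 G → ℝ} (hF : Measurable F) :
    kerE G r β c b η (F ∘ gaugeTransformZd g⁻¹ ∘ T) = kerE G r β c b η F := by
  haveI : SecondCountableTopology G := (Continuous.isClosedEmbedding r.continuous r.injective).isEmbedding.secondCountableTopology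
  have hFg : Measurable (F ∘ gaugeTransformZd g⁻¹) := hF.comp (measurable_gaugeTransformZd _)
  have h1 := hcov η (F ∘ gaugeTransformZd g⁻¹) hFg
  rw [hη, kerE_gaugeTransformZd r β c b η g hFg] at h1
  have e : (F ∘ gaugeTransformZd g⁻¹) ∘ gaugeTransformZd g = F := by
    funext U
    simp only [Function.comp_apply, gaugeTransformZd_inv_gaugeTransformZd]
  rw [e] at h1
  exact h1.symm

/-- The gauge fix does not change the corner density: `dens_x (g⁻¹·V) = dens_x V`. [folklore] -/
theorem dens_comp_gaugeFix (g : Site 4 → G) (T : LGConfig 4 G → LGConfig 4 G) (x : Fin 4 → ℤ) :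
    dens G r x ∘ gaugeTransformZd g⁻¹ ∘ T = dens G r x ∘ T := by
  funext U
  simp only [Function.comp_apply, dens_gaugeTransformZd]

omit [CompactSpace G] [MeasurableSpace G] [BorelSpace G] in
/-- Gauge transformations are continuous. [folklore] -/
theorem continuous_gaugeTransformZd_fix (g : Site 4 → G) : Continuous (gaugeTransformZd g : LGConfig 4 G → LGConfig 4 G) :=
  continuous_pi fun e => (continuous_const.mul (continuous_apply e)).mul continuous_const

/-! ## §2 Instances: midplane reflections and coordinate permutations symmetric up to gauge -/

/-- **Midplane time reflection up to gauge, gauge-fixed**: `boxTimeReflect c b η = g·η` ⇒ `kerE^η(F ∘ g⁻¹· ∘ boxTimeReflect c b) = kerE^η(F)`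
for every measurable `F`. [folklore] -/
theorem kerE_gaugeFix_boxTimeReflect_symm (β : ℝ) {c : Fin 4 → ℤ} {b : ℕ} {η : LGConfig 4 G} {g : Site 4 → G}
    (hη : boxTimeReflect c b η = gaugeTransformZd g η) {F : LGConfig 4 G → ℝ} (hF : Measurable F) :
    kerE G r β c b η (F ∘ gaugeTransformZd g⁻¹ ∘ boxTimeReflect c b) = kerE G r β c b η F :=
  kerE_symm_of_covariance_gauge r β c b (fun η' _ hF' => kerE_boxTimeReflect r β c b η' hF') hη hF

/-- **Midplane reflection of axis `k` up to gauge, gauge-fixed.** [folklore] -/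
theorem kerE_gaugeFix_boxAxisReflect_symm (β : ℝ) (k : Fin 4) {c : Fin 4 → ℤ} {b : ℕ} {η : LGConfig 4 G} {g : Site 4 → G}
    (hη : boxAxisReflect k c b η = gaugeTransformZd g η) {F : LGConfig 4 G → ℝ} (hF : Measurable F) :
    kerE G r β c b η (F ∘ gaugeTransformZd g⁻¹ ∘ boxAxisReflect k c b) = kerE G r β c b η F :=
  kerE_symm_of_covariance_gauge r β c b (fun η' _ hF' => kerE_boxAxisReflect r β k c b η' hF') hη hF

/-- **Coordinate permutation fixing the cube base, up to gauge, gauge-fixed**: `σ·c = c`, `σ·η = g·η` ⇒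
`kerE^η(F ∘ g⁻¹· ∘ σ·) = kerE^η(F)` for every measurable `F` (not only gauge-invariant ones, cf. `kerE_perm_gauge_symm_fun`). [folklore] -/
theorem kerE_gaugeFix_perm_symm (σ : Equiv.Perm (Fin 4)) (β : ℝ) {c : Fin 4 → ℤ} (hc : sitePerm σ c = c) (b : ℕ) {η : LGConfig 4 G}
    {g : Site 4 → G} (hη : relabelConfig (edgePerm σ) η = gaugeTransformZd g η) {F : LGConfig 4 G → ℝ} (hF : Measurable F) :
    kerE G r β c b η (F ∘ gaugeTransformZd g⁻¹ ∘ relabelConfig (edgePerm σ)) = kerE G r β c b η F := by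
  refine kerE_symm_of_covariance_gauge r β c b (T := relabelConfig (edgePerm σ)) (fun η' F' _ => ?_) hη hF
  have h := Summit.QuantumFields.YangMills.Cruxes.NT.BoundaryLaw.kerE_perm G r σ β c b η' F'
  rwa [hc] at h

omit [CompactSpace G] [BorelSpace G] in
/-- Continuity of the gauge-fixed midplane time reflection (hypothesis `hγ` of the orbit test). [folklore] -/
theorem continuous_gaugeFix_boxTimeReflect (g : Site 4 → G) (c : Fin 4 → ℤ) (b : ℕ) :
    Continuous (gaugeTransformZd g⁻¹ ∘ boxTimeReflect (G := G) c b) :=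
  (continuous_gaugeTransformZd_fix _).comp (continuous_boxTimeReflect c b)

omit [CompactSpace G] [BorelSpace G] in
/-- Continuity of the gauge-fixed midplane axis reflection. [folklore] -/
theorem continuous_gaugeFix_boxAxisReflect (g : Site 4 → G) (k : Fin 4) (c : Fin 4 → ℤ) (b : ℕ) :
    Continuous (gaugeTransformZd g⁻¹ ∘ boxAxisReflect (G := G) k c b) :=
  (continuous_gaugeTransformZd_fix _).comp (continuous_boxAxisReflect k c b)

omit [CompactSpace G] [BorelSpace G] in
/-- Continuity of the gauge-fixed coordinate permutation. [folklore] -/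
theorem continuous_gaugeFix_perm (g : Site 4 → G) (σ : Equiv.Perm (Fin 4)) :
    Continuous (gaugeTransformZd g⁻¹ ∘ relabelConfig (G := G) (edgePerm σ)) := by
  have hσ : Continuous (relabelConfig (G := G) (edgePerm σ)) := by
    refine continuous_pi fun e => ?_
    simp only [relabelConfig_apply]
    exact continuous_apply _
  exact (continuous_gaugeTransformZd_fix _).comp hσ

/-! ## §3 The orbit-sum side: the fixed maps act on the density exactly as the unfixed ones -/

/-- Orbit sums are unchanged by the gauge fix: `dens_x ((g⁻¹· ∘ T) U) = dens_x (T U)`. [folklore] -/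
theorem dens_gaugeFix_apply (g : Site 4 → G) (T : LGConfig 4 G → LGConfig 4 G) (x : Fin 4 → ℤ)
    (U : LGConfig 4 G) : dens G r x ((gaugeTransformZd g⁻¹ ∘ T) U) = dens G r x (T U) := by
  simp only [Function.comp_apply, dens_gaugeTransformZd]

end Summit.QuantumFields.YangMills.Cruxes.NT.ClassicalShadow

end
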